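import Literature.Computability.Cryptography.WordRAMStructured
import Literature.Computability.Cryptography.WordRAMEmulator
import HarnessLib

/-!
# The word RAM — structured programs around an emulated sub-run

The shape of every "algorithm from a hypothetical algorithm" argument of fine-grained and
parameterized complexity (V. Vassilevska Williams, ICM 2018, §2, the remark after Def. 2.1 and
Prop. 2.2; Chen–Huang–Kanj–Xia, JCSS 72 (2006), Lemma 2.2 / Thm. 5.5): a program first *builds*
an instance `y` of another problem from its input `x` (structured code `pre`, verified in the
big-step semantics `SProg.Exec` of `…WordRAMStructured`), then *runs a given oracle-free
deterministic program* `M` on `y` — at `M`'s own, smaller, word size, in relocated memory: the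
emulator `compile` of `…WordRAMEmulator` — and finally *reads off* `M`'s output (structured code
`post`). This file packages the three parts into one program and proves its output/time
certificate from the three local certificates:

* `noQB`: the empty query-block compiler (the emulated source is oracle-free), and the facts that
  the emulator's code is then `rand`- and `query`-free (`isRand_of_mem_emuCompile`,
  `isQuery_of_mem_emuCompile`);
* `SProg.withSubrun pre L M post`: the program
  `pre.compile 0 ++ compile L 0 M |pre| noQB ++ post.compile exit ++ [halt]`
  (`exit = exitPos L 0 M |pre|`), with `withSubrun_isDeterministic`, `withSubrun_isOracleFree`;
* **`SProg.outputsWithin_withSubrun`**: if `pre` executes from the initial store of `x` to a store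
  `st₁` in `t₁` steps, `st₁` presents to the emulator (layout `L`, environment `E`) the initial
  memory of `M` on `y` (`Agree E st₁.mem (init E.ws y).mem`, `TInv`), `M` halts on `y` at word
  size `E.ws` within `n` steps in `dh`, and from every memory agreeing with `dh.mem` (target
  invariant kept, everything outside the emulator's footprint as in `st₁`) `post` executes within
  `T₂` steps to a store with read-out `out`, then `withSubrun pre L M post` outputs `out` on `x`
  within `t₁ + cstep · n + T₂ + 1` steps (`cstep = 38`).

## References

* V. Vassilevska Williams, *On some fine-grained questions in algorithms and complexity*,
  Proc. ICM 2018, §2 (word RAM; Def. 2.1, the remark following it, Prop. 2.2).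
* J. Chen, X. Huang, I. A. Kanj, G. Xia, *Strong computational lower bounds via parameterized
  complexity*, JCSS 72 (2006), §2 (algorithms calling a hypothetical algorithm on a constructed
  instance).
* T. Nipkow, G. Klein, *Concrete Semantics with Isabelle/HOL*, Springer 2014, §8.4.
-/

namespace Literature.Computability.Cryptography.WordRAM

open StateTransition

/-! ## Empty query blocks: the emulator's code is deterministic and oracle-free -/

/-- The query-block compiler for oracle-free sources: every `query` compiles to no code.
[folklore] -/
def noQB : ℕ → Operand → Operand → Operand → List Instr := fun _ _ _ _ => []

/-- Query blocks of `noQB` have length `0`. [folklore] -/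
theorem length_noQB (pos : ℕ) (qa ql aa : Operand) : (noQB pos qa ql aa).length = 0 := rfl

/-- The instruction of an operation is not `rand`. [folklore] -/
theorem OpSpec.isRand_toInstr (s : OpSpec) : s.toInstr.isRand = false := rfl

/-- The instruction of an operation is not `query`. [folklore] -/
theorem OpSpec.isQuery_toInstr (s : OpSpec) : s.toInstr.isQuery = false := rfl

/-- The instructions of a block of the emulator (empty query blocks) are `op`, `jmp` or `jz`:
neither `rand` nor `query`. [folklore] -/
theorem isRand_isQuery_of_mem_blkAt (L : Layout) (M : Program) (base i : ℕ) (I : Instr)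
    (h : I ∈ blkAt L 0 M base noQB i) : I.isRand = false ∧ I.isQuery = false := by
  unfold blkAt at h
  rcases hM : M[i]? with _ | ⟨o, d, x, y⟩ | t | ⟨x, t⟩ | d | ⟨qa, ql, aa⟩ | _
  · rw [hM] at h; simp at h
  · rw [hM] at h
    simp only [List.mem_map] at h
    obtain ⟨s, -, rfl⟩ := h
    exact ⟨s.isRand_toInstr, s.isQuery_toInstr⟩
  · rw [hM] at h
    simp only [List.mem_singleton] at h
    subst h; exact ⟨rfl, rfl⟩
  · rw [hM] at h
    simp only [List.mem_append, List.mem_map, List.mem_singleton] at h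
    rcases h with ⟨s, -, rfl⟩ | rfl
    · exact ⟨s.isRand_toInstr, s.isQuery_toInstr⟩
    · exact ⟨rfl, rfl⟩
  · rw [hM] at h
    simp only [List.mem_singleton] at h
    subst h; exact ⟨rfl, rfl⟩
  · rw [hM] at h
    simp [noQB] at h
  · rw [hM] at h
    simp only [List.mem_singleton] at h
    subst h; exact ⟨rfl, rfl⟩

/-- The emulator's code (empty query blocks) contains no `rand`. [folklore] -/
theorem isRand_of_mem_emuCompile (L : Layout) (M : Program) (base : ℕ) (I : Instr)
    (h : I ∈ compile L 0 M base noQB) : I.isRand = false := by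
  simp only [compile, List.mem_flatten, List.mem_map, List.mem_range] at h
  obtain ⟨blk, ⟨i, -, rfl⟩, hI⟩ := h
  exact (isRand_isQuery_of_mem_blkAt L M base i I hI).1

/-- The emulator's code (empty query blocks) contains no `query`. [folklore] -/
theorem isQuery_of_mem_emuCompile (L : Layout) (M : Program) (base : ℕ) (I : Instr)
    (h : I ∈ compile L 0 M base noQB) : I.isQuery = false := by
  simp only [compile, List.mem_flatten, List.mem_map, List.mem_range] at h
  obtain ⟨blk, ⟨i, -, rfl⟩, hI⟩ := h
  exact (isRand_isQuery_of_mem_blkAt L M base i I hI).2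

/-- The emulator's code for an oracle-free source `M` placed at `base` (layout `L`, empty query
blocks). [folklore] -/
def emuCode (L : Layout) (M : Program) (base : ℕ) : List Instr :=
  compile L 0 M base noQB

/-- The emulator's code ends at its exit position. [folklore] -/
theorem length_emuCode (L : Layout) (M : Program) (base : ℕ) :
    base + (emuCode L M base).length = exitPos L 0 M base := by
  have := length_compile (L := L) (qlen := 0) (M := M) (base := base) (qb := noQB) length_noQB
  unfold emuCode; omega

namespace SProg

/-! ## The program: build, emulated sub-run, read-out -/

/-- **Structured code around an emulated sub-run**: the code of `pre` at `0`, the emulator of `M`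
(layout `L`, empty query blocks) at `|pre|`, the code of `post` at the emulator's exit, `halt`.
[folklore] -/
def withSubrun (pre : SProg) (L : Layout) (M : Program) (post : SProg) : Program :=
  pre.compile 0 ++ emuCode L M pre.len ++ post.compile (exitPos L 0 M pre.len) ++ [.halt]

/-- `withSubrun` programs are deterministic. [folklore] -/
theorem withSubrun_isDeterministic (pre : SProg) (L : Layout) (M : Program) (post : SProg) :
    (withSubrun pre L M post).IsDeterministic := by
  intro I hI
  simp only [withSubrun, List.mem_append, List.mem_singleton] at hI
  rcases hI with ((h | h) | h) | rfl
  · exact isRand_of_mem_compile pre 0 I h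
  · exact isRand_of_mem_emuCompile L M pre.len I h
  · exact isRand_of_mem_compile post _ I h
  · rfl

/-- `withSubrun` programs with query-free `pre` and `post` are oracle-free. [folklore] -/
theorem withSubrun_isOracleFree {pre post : SProg} (hpre : pre.QueryFree) (hpost : post.QueryFree)
    (L : Layout) (M : Program) : (withSubrun pre L M post).IsOracleFree := by
  intro I hI
  simp only [withSubrun, List.mem_append, List.mem_singleton] at hI
  rcases hI with ((h | h) | h) | rfl
  · exact isQuery_of_mem_compile pre hpre 0 I h
  · exact isQuery_of_mem_emuCompile L M pre.len I h
  · exact isQuery_of_mem_compile post hpost _ I h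
  · rfl

/-- Placement of the three parts and of the final `halt` inside `withSubrun`. [folklore] -/
theorem codeAt_withSubrun (pre : SProg) (L : Layout) (M : Program) (post : SProg) :
    CodeAt (withSubrun pre L M post) 0 (pre.compile 0) ∧
      CodeAt (withSubrun pre L M post) pre.len (emuCode L M pre.len) ∧
      CodeAt (withSubrun pre L M post) (exitPos L 0 M pre.len)
        (post.compile (exitPos L 0 M pre.len)) ∧
      (withSubrun pre L M post)[exitPos L 0 M pre.len + post.len]? = some .halt := by
  have hex := (length_emuCode L M pre.len).symm
  refine ⟨?_, ?_, ?_, ?_⟩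
  · have := codeAt_append_middle [] (pre.compile 0)
      (emuCode L M pre.len ++ post.compile (exitPos L 0 M pre.len) ++ [.halt])
    simpa [withSubrun, List.append_assoc] using this
  · have := codeAt_append_middle (pre.compile 0) (emuCode L M pre.len)
      (post.compile (exitPos L 0 M pre.len) ++ [.halt])
    simpa [withSubrun, List.append_assoc] using this
  · have := codeAt_append_middle (pre.compile 0 ++ emuCode L M pre.len)
      (post.compile (exitPos L 0 M pre.len)) [.halt]
    simp only [List.length_append, length_compile] at this
    rw [← hex] at this
    simpa [withSubrun, List.append_assoc] using this
  · simp only [withSubrun]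
    rw [List.getElem?_append_right (by simp [hex]; omega), List.length_append, List.length_append,
      length_compile, length_compile]
    simp [hex]

/-- **Output certificate of a program with an emulated sub-run.** Let `pre` execute from the
initial store of input `x` (word size `W`, `inputWidth x ≤ W`) to `st₁` in `t₁` steps; let the
layout `L` and environment `E` be admissible at `W` (`EnvOK`, `VT = 2 ^ W - 1`, register
addresses `≤ VT`); let `M` be deterministic and oracle-free with constants `≤ V`, where
`2 ^ ws - 1 ≤ V < Q`, `V ≤ VT`, `1 ≤ V`; let `st₁` satisfy the target invariant and present the
initial memory of `M` on `y` at word size `ws = E.ws` (`Agree E st₁.mem (init ws y).mem`); let `M`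
halt on `y` within `n` steps in `dh`; and let `post`, from every memory agreeing with `dh.mem`
that satisfies the target invariant and coincides with `st₁.mem` outside the emulator's
footprint (query log that of `st₁`), execute within `T₂` steps to a store whose read-out is
`out`. Then `withSubrun pre L M post` outputs `out` on `x` within `t₁ + cstep * n + T₂ + 1` steps.
[folklore] -/
theorem outputsWithin_withSubrun {W : ℕ} {O : List ℕ → List ℕ} (ρ : ℕ → ℕ) {pre post : SProg}
    {L : Layout} {E : Env} {VT V : ℕ} {M : Program} {x y out : List ℕ} {st₁ : Store} {t₁ n T₂ : ℕ}
    {dh : Cfg} (hx : inputWidth x ≤ W) (hpre : Exec W O pre ⟨initFun x, []⟩ st₁ t₁)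
    (hOK : EnvOK L E W) (hVT : VT + 1 = 2 ^ W) (h1 : 1 ≤ VT) (hregV : ∀ r ∈ L.regs, r ≤ VT)
    (hdet : M.IsDeterministic) (hof : M.IsOracleFree) (hMV : Program.maxConst M ≤ V)
    (hVQ : V < E.Q) (hVVT : V ≤ VT) (hwsV : 2 ^ E.ws - 1 ≤ V) (h1V : 1 ≤ V)
    (hinv : TInv L E VT st₁.mem) (hag : Agree E st₁.mem (init E.ws y).mem)
    (hM : HaltsWithin M E.ws noOracle zeroCoins y n dh)
    (hpost : ∀ m₂ : ℕ → ℕ, Agree E m₂ dh.mem → TInv L E VT m₂ →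
      (∀ c, ¬ Foot L E c → m₂ c = st₁.mem c) →
      ∃ (st₃ : Store) (t₃ : ℕ), t₃ ≤ T₂ ∧ Exec W O post ⟨m₂, st₁.queries⟩ st₃ t₃ ∧
        readOut st₃.mem = out) :
    OutputsWithin (withSubrun pre L M post) W O ρ x out (t₁ + cstep * n + T₂ + 1) := by
  obtain ⟨hc₁, hc₂, hc₃, hhalt⟩ := codeAt_withSubrun pre L M post
  set P := withSubrun pre L M post
  -- the build
  have hrun₁ : run P W O ρ t₁ (init W x) = some (st₁.cfg (some pre.len) 0) := by
    have h := hpre.run_eq hc₁ 0 ρ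
    have hinit : (⟨initFun x, []⟩ : Store).cfg (some 0) 0 = init W x := by
      rw [← init_mem_eq_initFun hx]; rfl
    rwa [hinit, Nat.zero_add] at h
  -- the emulated sub-run
  obtain ⟨n', hn', hrunM, hstepM⟩ := hM.exists_run
  have hpcM : dh.pc = none := (step_eq_none_iff _ _ _ _ _).1 hstepM
  have hrel : ERel L E VT M pre.len 0 (init E.ws y) (st₁.cfg (some pre.len) 0) :=
    ⟨by simp [bstart_zero], hag, hinv⟩
  have hdm : MemLE V (init E.ws y).mem := init_memLE _ _ hwsV
  obtain ⟨m, hm, eh, hrun₂, hpc₂, hag₂, hinv₂, -, hqu₂, hfr₂⟩ :=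
    emu_halt hOK hVT h1 hregV length_noQB hc₂ hdet hof hMV hVQ hVVT hwsV h1V O ρ hrel hdm hrunM hpcM
  -- the read-out
  obtain ⟨st₃, t₃, ht₃, hpost₃, hout⟩ := hpost eh.mem hag₂ hinv₂ (fun c hc => by
    simpa using hfr₂ c hc)
  have heh : eh = (⟨eh.mem, st₁.queries⟩ : Store).cfg (some (exitPos L 0 M pre.len)) eh.coinPos := by
    cases eh
    simp only [Store.cfg_queries] at hpc₂ hqu₂
    simp only [Store.cfg, hpc₂, hqu₂]
  have hrun₃ : run P W O ρ t₃ eh =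
      some (st₃.cfg (some (exitPos L 0 M pre.len + post.len)) eh.coinPos) := by
    have h := hpost₃.run_eq hc₃ eh.coinPos ρ
    rwa [← heh] at h
  -- the final `halt`
  have hrun₄ : run P W O ρ 1 (st₃.cfg (some (exitPos L 0 M pre.len + post.len)) eh.coinPos) =
      some (st₃.cfg none eh.coinPos) := by
    rw [run_one, step_halt (i := exitPos L 0 M pre.len + post.len) rfl hhalt]
    rfl
  have hall := run_add_of_run _ _ _ _ (run_add_of_run _ _ _ _ (run_add_of_run _ _ _ _ hrun₁ hrun₂)
    hrun₃) hrun₄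
  have hT : t₁ + m + t₃ + 1 ≤ t₁ + cstep * n + T₂ + 1 := by
    have : m ≤ cstep * n := hm.trans (Nat.mul_le_mul_left _ hn')
    omega
  have := outputsWithin_of_run hall (step_of_pc_eq_none rfl) hT
  rwa [Store.cfg_mem, hout] at this

end SProg

end Literature.Computability.Cryptography.WordRAM
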